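import Literature.AlgebraicGeometry.HodgeTheory.BettiHypersurfaceOffMiddleBettiNumbersPicardNumberOne
import Literature.AlgebraicGeometry.HodgeTheory.FermatOddMiddleBettiNumber
import Literature.AlgebraicGeometry.HodgeTheory.BettiPrimitiveCohomologyHodgeNumbers
import Literature.AlgebraicGeometry.HodgeTheory.BettiHardLefschetzInequalities
import HarnessLib

/-!
# The primitive middle Betti number of a smooth hypersurface in closed form, `d · b_m(Y)_pr = (d−1)^{m+2} + (−1)^m (d−1)`, in EVERY dimension: the odd-dimensional EQUALITY
# `b_{2r+1}(Y) = ((d−1)^{2r+3} − (d−1))/d`, the Euler number `d · E(Y) = (1−d)^{m+2} + d(m+2) − 1`, and cubic hypersurfaces in all dimensions (`6 b_m = 2^{m+3} + 3 + (−1)^m 7`)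
# (Huybrechts 2023 Ch. 1 §1.3 Cor. 1.12, (1.6), Exercises 1.13–1.14; Eisenbud–Harris 2016 Example 5.24, Table 5.1; Shioda 1979 §1)

Family `hodge`, lane `lit-hodgefound` (Track 2 foundations library; Layers A1/A4), layer `Literature/AlgebraicGeometry/HodgeTheory`.  THEOREMS ONLY (no definition, no named fact, no instance,
no notation; D-0026 net debt `0`).  Prover seat `lit-hodgefound-p21` (generation 42, row g42-#1), sequel of the seat's g41-#2 (`BettiHypersurfaceMiddleBettiNumberClosedFormSurfaceDiamond`:
`d · N_k = (d−1)^k + (−1)^k (d−1)` for Shioda's count, `b_{2r}(Y)` in closed form, `b_{2r+1}(Y) ≤ …` ONE-SIDED) and g41-#5 (`BettiHypersurfaceOffMiddleBettiNumbersPicardNumberOne`: `E(Y) = m + b_m`,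
`= m + 1 − b_m`, `E ≥ …` one-sided in odd dimension).  What makes the odd-dimensional equalities available now is the hodge-nonav seats' `FermatOddMiddleBettiNumber`
(`finrank_bettiCohomology_middle_hypersurface_odd`: `b₂ₚ₊₁(X_F) = |𝔄²ᵖ⁺¹_d|`, `p ≥ 1`, from `fermatEigenspace_ne_bot_odd`), which g41-#2 did not yet use.

THE MATHEMATICS (Huybrechts, Ch. 1 §1.3).  For a smooth hypersurface `X ⊂ ℙ^{n+1}` of degree `d` and dimension `n > 0`, `b_i(X) = b_i(ℙ^{n+1})` for `i ≠ n` (Lefschetz), so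
`e(X) = n + b_n(X)` (`n` even), `= n + 1 − b_n(X)` (`n` odd); the PRIMITIVE middle Betti number `b_n(X)_pr := dim_ℚ Hⁿ(X, ℚ)_pr` «equals `b_n(X) − 1` for even `n > 0` and `b_n(X)` for
`n` odd», `b_n(X)_pr = (−1)ⁿ (e(X) − (n+1))`, and `e(X) = ∫ c_n(X)` with `c(X) = (1+h)^{n+2}(1+dh)^{−1}` gives «`e(X) = (1/d)((1−d)^{n+2} + d(n+2) − 1)`» and **Corollary 1.12**
«`b_n(X)_pr = ((−1)ⁿ/d)(d − 1 + (1−d)^{n+2})`».  For cubics (`d = 3`): (1.6) «`e(X) = (1/3)((−2)^{n+2} + 3n + 5)`», the table (p. 24: `e = 9, −6, 27, −36, 93, −162`; `b_n = 7, 10, 23, 42, 87,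
170`), **Exercise 1.13** «`b_{n+1,pr} = 2 b_{n−1,pr} + b_{n,pr}`» and **Exercise 1.14** «`b_n = (1/6)(2^{n+3} + 3 + (−1)ⁿ·7)` … `b_{2m+1} = 2 b_{2m} − 4`».  Eisenbud–Harris Example 5.24 /
Table 5.1 (held text p. 211): cubic∕quartic∕quintic threefold `χ = −6, −56, −200`, `b₃ = 10, 60, 204`.  In the tree the middle Betti number comes from Ehresmann constancy over the universal
smooth hypersurface and Shioda's character decomposition of the Fermat variety (`b_m(X_F) = #𝔄ᵐ_d + [m even]`), and g41-#2 solved Shioda's recursion to `d · #𝔄ᵐ_d = (d−1)^{m+2} + (−1)^m (d−1)`;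
this file assembles: §1 the model equality in odd dimension, §2 the abstract presentation `IsSmoothHypersurface m d Y` (`Y ≅ X_F`, g41-#1) with the parity-uniform Cor. 1.12 and the vanishing
criterion `b_{2r+1}(Y) = 0 ⟺ d ≤ 2`, §3 the primitive cohomology `Pᵐ(Y) ⊆ Hᵐ(Y)` of any hard-Lefschetz class (`dim Pᵐ = b_m − b_{m−2}`, the tree's `BettiUniverse.finrank_primitiveClasses_add_finrank`),
§4 the Euler number, §5 cubic hypersurfaces in every dimension.

THE OBJECTS (all the tree's).  `IsSmoothHypersurface m d Y`, `SmoothHypersurface.hypersurface F`, `SmoothHypersurface.IsNonsingularForm`, `bettiCohomology Y k = Hᵏ(Y(ℂ); ℚ)`, `complexBetti`,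
`primitiveClasses κ m a` for `κ ∈ H²` with `HasHardLefschetzProperty κ m`; `finrank_bettiCohomology_middle_hypersurface_odd` (`FermatOddMiddleBettiNumber`), `card_fermatAdmissible_eq_div_of_odd`,
`mul_card_fermatAdmissible_add_of_odd`, `IsSmoothHypersurface.finrank_bettiCohomology_middle_even_eq_div`, `…mul_finrank_bettiCohomology_middle_even_sub_one` (g41-#2),
`IsSmoothHypersurface.eulerChar_eq_of_even ∕ _of_odd`, `…finrank_bettiCohomology_two_mul_eq_one`, `…finrank_bettiCohomology_eq_zero_of_odd`, `…finrank_bettiCohomology_middle_eq_zero_of_degree_le_two`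
(g41-#4∕#5), `exists_isNonsingularForm_iso_hypersurface`, `BettiUniverse.finrank_bettiCohomology_eq_of_iso` (g41-#1), `BettiUniverse.finrank_primitiveClasses_add_finrank` (`BettiHardLefschetzInequalities`),
`BettiUniverse.finrank_primitiveClasses_complex_add_finrank` (`BettiPrimitiveCohomologyHodgeNumbers`).

WHAT IS PROVED.
* §1 MODEL: **`finrank_bettiCohomology_middle_hypersurface_odd_eq_div`** (`b₂ₚ₊₁(X_F) = ((d−1)^{2p+3} − (d−1))/d`, `p ≥ 1`), `mul_finrank_bettiCohomology_middle_hypersurface_odd_add` (`d·b + (d−1) = (d−1)^{2p+3}`).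
* §2 ABSTRACT: **`IsSmoothHypersurface.finrank_bettiCohomology_middle_odd_eq_div`** (`b_{2r+1}(Y) = ((d−1)^{2r+3} − (d−1))/d`, `r ≥ 1`), `…mul_finrank_bettiCohomology_middle_odd_add`,
  **`…natCast_mul_finrank_bettiCohomology_middle_sub`** (Cor. 1.12, all `m ≥ 2`: `d·(b_m − [m even]) = (d−1)^{m+2} + (−1)^m(d−1)` in `ℤ`), `…finrank_bettiCohomology_middle_eq_zero_iff_of_odd` (`b_{2r+1} = 0 ⟺ d ≤ 2`),
  `…finrank_bettiCohomology_middle_pos_iff_of_odd` (`0 < b_{2r+1} ⟺ 3 ≤ d`); instances `finrank_bettiCohomology_three_cubicThreefold` (`10`), `…quarticThreefold` (`60`), `…quinticThreefold` (`204`),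
  `…sexticThreefold` (`520`), `finrank_bettiCohomology_three_threefold_add` (`b₃ + (d−1)³ + (d−1) = (d−1)⁴ + (d−1)²`), `finrank_bettiCohomology_five_cubicFivefold` (`42`), `finrank_bettiCohomology_seven_cubicSevenfold` (`170`).
* §3 PRIMITIVE: `…finrank_primitiveClasses_middle_of_odd` (`dim Pᵐ = b_m`), `…finrank_primitiveClasses_middle_add_one_of_even` (`dim Pᵐ + 1 = b_m`), **`…natCast_mul_finrank_primitiveClasses_middle`**
  (`d · dim_ℚ Pᵐ = (d−1)^{m+2} + (−1)^m (d−1)`), **`…natCast_mul_finrank_primitiveClasses_middle_eq_neg_one_pow_mul`** (Cor. 1.12 verbatim: `d · b_{m,pr} = (−1)^m (d − 1 + (1−d)^{m+2})`),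
  `…natCast_mul_finrank_primitiveClasses_complex_middle` (complex coefficients).
* §4 EULER NUMBER: **`…eulerChar_eq_sub_div_of_odd`** (`E(Y) = m + 1 − ((d−1)^{m+2} − (d−1))/d`), **`…natCast_mul_eulerChar`** (`d·E(Y) = (1−d)^{m+2} + d(m+2) − 1`, all `m ≥ 2`), `…eulerChar_threefold`
  (`E(T_d) = −d⁴ + 5d³ − 10d² + 10d`), `eulerChar_cubicThreefold` (`−6`), `…quarticThreefold` (`−56`), `…quinticThreefold` (`−200`), `…cubicFivefold` (`−36`).
* §5 CUBICS: **`…six_mul_finrank_bettiCohomology_middle_cubic`** (`6 b_m = 2^{m+3} + 3 + (−1)^m 7`), `…three_mul_eulerChar_cubic` (`3E = (−2)^{m+2} + 3m + 5`), **`finrank_bettiCohomology_middle_cubic_succ_add_one`**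
  (Exercise 1.13 in absolute form: `b_{m+1} + 1 = 2 b_{m−1} + b_m`), `finrank_bettiCohomology_middle_cubic_odd_add_four` (`b_{2r+1} + 4 = 2 b_{2r}`).

DEVIATIONS / SCOPE.  Plane curves (`m = 1`: `b₁ = (d−1)(d−2)`) are the tree's `finrank_bettiCohomology_one_planeCurve'` and are excluded (`m ≥ 2` throughout, as in the model lemmas); the
individual middle Hodge numbers beyond `h^{m,0}` are not touched here (threefolds: the seat's next row); signatures `τ(X)` and `(b⁺, b⁻)` of Huybrechts' table are not formalised.

## References
* [Huybrechts2023Cubic] D. Huybrechts, *The Geometry of Cubic Hypersurfaces*, CUP (2023) — Ch. 1 §1.3 Cor. 1.12, (1.6), Exercises 1.13–1.14 and the table (held text pp. 22–24); Ch. 5 §0.1 (p. 226).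
* [EisenbudHarris2016] D. Eisenbud, J. Harris, *3264 and All That* (2016) — §5.7 Example 5.24 and Table 5.1 (held text p. 211).
* [Shioda1979HodgeFermat] T. Shioda, *The Hodge conjecture for Fermat varieties*, Math. Ann. 245 (1979) — §1 (1.3)–(1.4).
* [VoisinHodgeI2002] C. Voisin, *Hodge Theory and Complex Algebraic Geometry I* (2002) — §6.2.3 Def. 6.24, Cor. 6.26.
* [VoisinHodgeII2003] C. Voisin, *Hodge Theory and Complex Algebraic Geometry II* (2003) — §1.2.3 Cor. 1.24–1.25.
* [Hartshorne1977] R. Hartshorne, *Algebraic Geometry* (1977) — II Ex. 3.11 (d).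

## Provenance
Lane `lit-hodgefound` (Hodge path, Track 2), prover seat `lit-hodgefound-p21` (generation 42), self-proposed row g42-#1 (uses the hodge-nonav seats' `FermatOddMiddleBettiNumber` and p29's
`BettiHardLefschetzInequalities` ∕ `BettiPrimitiveCohomologyHodgeNumbers`).
-/

noncomputable section

open CategoryTheory Module Finset
open Literature.AlgebraicTopology.SingularHomology
open Literature.Geometry.Kaehler

namespace Literature.AlgebraicGeometry.HodgeTheory

open Literature.AlgebraicGeometry.Motives
open Literature.AlgebraicGeometry.Motives.HodgeStructure

/-! ### §1 The middle Betti number of the odd-dimensional model hypersurface `X_F` in closed form -/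

section Model

variable {d : ℕ}

/-- **`b_{2p+1}(X_F) = ((d−1)^{2p+3} − (d−1))/d`** for every nonsingular form `F` of degree `d ≥ 1` in `2p + 3` variables, `p ≥ 1` — the closed form of the tree's EQUALITY
`finrank_bettiCohomology_middle_hypersurface_odd` (`= #𝔄^{2p+1}_d`, Shioda) through g41-#2's `card_fermatAdmissible_eq_div_of_odd`; Eisenbud–Harris Table 5.1: cubic∕quartic∕quintic threefold `10, 60, 204`.
[cite: Huybrechts2023Cubic, Ch. 1 §1.3 Cor. 1.12] [cite: EisenbudHarris2016, Example 5.24 and Table 5.1] [cite: Shioda1979HodgeFermat, §1 (1.3)–(1.4)] -/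
theorem finrank_bettiCohomology_middle_hypersurface_odd_eq_div [NeZero d] {p : ℕ} (hp : 1 ≤ p) (F : MvPolynomial (Fin (2 * p + 1 + 2)) ℂ) (hF : F.IsHomogeneous d)
    (hFns : SmoothHypersurface.IsNonsingularForm ℂ F) :
    Module.finrank ℚ (bettiCohomology (SmoothHypersurface.hypersurface F) (2 * p + 1)) = ((d - 1) ^ (2 * p + 3) - (d - 1)) / d := by
  rw [finrank_bettiCohomology_middle_hypersurface_odd hp F hF hFns, card_fermatAdmissible_eq_div_of_odd d ⟨p + 1, by ring⟩]

/-- The same without division: **`d · b_{2p+1}(X_F) + (d−1) = (d−1)^{2p+3}`**. [cite: Huybrechts2023Cubic, Ch. 1 §1.3 Cor. 1.12] [cite: Shioda1979HodgeFermat, §1 (1.3)–(1.4)] -/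
theorem mul_finrank_bettiCohomology_middle_hypersurface_odd_add [NeZero d] {p : ℕ} (hp : 1 ≤ p) (F : MvPolynomial (Fin (2 * p + 1 + 2)) ℂ) (hF : F.IsHomogeneous d)
    (hFns : SmoothHypersurface.IsNonsingularForm ℂ F) :
    d * Module.finrank ℚ (bettiCohomology (SmoothHypersurface.hypersurface F) (2 * p + 1)) + (d - 1) = (d - 1) ^ (2 * p + 3) := by
  rw [finrank_bettiCohomology_middle_hypersurface_odd hp F hF hFns]
  exact mul_card_fermatAdmissible_add_of_odd d ⟨p + 1, by ring⟩

end Model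

end Literature.AlgebraicGeometry.HodgeTheory

namespace Literature.AlgebraicGeometry.Motives.IsSmoothHypersurface

open Literature.AlgebraicGeometry.Motives
open Literature.AlgebraicGeometry.Motives.HodgeStructure
open Literature.AlgebraicGeometry.HodgeTheory

variable {m d r : ℕ} {X Y Y' Y'' T : SchemeOver ℂ}

/-! ### §2 The middle Betti number of an ABSTRACT smooth hypersurface of odd dimension; Cor. 1.12 uniformly in the parity -/

section Middle

/-- **`b_{2r+1}(Y) = ((d−1)^{2r+3} − (d−1))/d` for every smooth hypersurface `Y ⊂ ℙ^{2r+2}_ℂ` of odd dimension `m = 2r + 1 ≥ 3` and degree `d`** (abstract presentation, transported along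
`Y ≅ X_F`; EQUALITY, closing the one-sided `finrank_bettiCohomology_middle_odd_le_div` of g41-#2). [cite: Huybrechts2023Cubic, Ch. 1 §1.3 Cor. 1.12] [cite: EisenbudHarris2016, Example 5.24 and Table 5.1]
[cite: Hartshorne1977, II Ex. 3.11 (d)] -/
theorem finrank_bettiCohomology_middle_odd_eq_div (hY : IsSmoothHypersurface m d Y) (hm : m = 2 * r + 1) (hr : 1 ≤ r) :
    Module.finrank ℚ (bettiCohomology Y m) = ((d - 1) ^ (m + 2) - (d - 1)) / d := by
  subst hm
  haveI : NeZero d := ⟨(pos_of_isSmoothHypersurface hY).ne'⟩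
  obtain ⟨F, hF, -, hJ, ⟨e⟩⟩ := hY.exists_isNonsingularForm_iso_hypersurface
  rw [BettiUniverse.finrank_bettiCohomology_eq_of_iso e (2 * r + 1)]
  exact finrank_bettiCohomology_middle_hypersurface_odd_eq_div hr F hF hJ

/-- The same without division: **`d · b_{2r+1}(Y) + (d−1) = (d−1)^{2r+3}`**. [cite: Huybrechts2023Cubic, Ch. 1 §1.3 Cor. 1.12] -/
theorem mul_finrank_bettiCohomology_middle_odd_add (hY : IsSmoothHypersurface m d Y) (hm : m = 2 * r + 1) (hr : 1 ≤ r) :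
    d * Module.finrank ℚ (bettiCohomology Y m) + (d - 1) = (d - 1) ^ (m + 2) := by
  subst hm
  haveI : NeZero d := ⟨(pos_of_isSmoothHypersurface hY).ne'⟩
  obtain ⟨F, hF, -, hJ, ⟨e⟩⟩ := hY.exists_isNonsingularForm_iso_hypersurface
  rw [BettiUniverse.finrank_bettiCohomology_eq_of_iso e (2 * r + 1)]
  exact mul_finrank_bettiCohomology_middle_hypersurface_odd_add hr F hF hJ

/-- **Corollary 1.12 (Huybrechts), uniform in the parity: `d · (b_m(Y) − [m even]) = (d−1)^{m+2} + (−1)^m (d−1)`** in `ℤ`, for every smooth hypersurface of dimension `m ≥ 2` and degree `d`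
(`b_m − [m even] = b_{m,pr}` is the primitive middle Betti number, §3). [cite: Huybrechts2023Cubic, Ch. 1 §1.3 Cor. 1.12] [cite: EisenbudHarris2016, Example 5.24] -/
theorem natCast_mul_finrank_bettiCohomology_middle_sub (hY : IsSmoothHypersurface m d Y) (hm : 2 ≤ m) :
    (d : ℤ) * ((Module.finrank ℚ (bettiCohomology Y m) : ℤ) - if Even m then 1 else 0) = ((d : ℤ) - 1) ^ (m + 2) + (-1) ^ m * ((d : ℤ) - 1) := by
  have hd : 1 ≤ d := pos_of_isSmoothHypersurface hY
  rcases Nat.even_or_odd m with ⟨r, hr⟩ | ⟨r, hr⟩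
  · have hm' : m = 2 * r := by omega
    have hr1 : 1 ≤ r := by omega
    have h := hY.mul_finrank_bettiCohomology_middle_even_sub_one hm' hr1
    have hb : 1 ≤ Module.finrank ℚ (bettiCohomology Y m) := by
      rw [hY.finrank_bettiCohomology_middle_even_eq_div hm' hr1]
      exact Nat.le_add_left 1 _
    rw [if_pos ⟨r, hr⟩, Even.neg_one_pow ⟨r, hr⟩, one_mul]
    have h' := congrArg (fun n : ℕ ↦ (n : ℤ)) h
    simp only [Nat.cast_mul, Nat.cast_sub hb, Nat.cast_add, Nat.cast_pow, Nat.cast_sub hd, Nat.cast_one] at h'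
    linear_combination h'
  · have hr1 : 1 ≤ r := by omega
    have h := hY.mul_finrank_bettiCohomology_middle_odd_add hr hr1
    rw [if_neg (Nat.not_even_iff_odd.2 ⟨r, hr⟩), Odd.neg_one_pow ⟨r, hr⟩, sub_zero, neg_one_mul]
    have h' := congrArg (fun n : ℕ ↦ (n : ℤ)) h
    simp only [Nat.cast_mul, Nat.cast_add, Nat.cast_pow, Nat.cast_sub hd, Nat.cast_one] at h'
    linear_combination h'

/-- **`b_{2r+1}(Y) = 0 ⟺ d ≤ 2`** for a smooth hypersurface of odd dimension `m = 2r + 1 ≥ 3`: hyperplanes and quadrics are the only odd-dimensional smooth hypersurfaces without middle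
cohomology (`d ≥ 3 ⟹ (d−1)^{m+2} > d − 1`). [cite: Huybrechts2023Cubic, Ch. 1 §1.3 Cor. 1.12] [cite: EisenbudHarris2016, Example 5.24 and Table 5.1] -/
theorem finrank_bettiCohomology_middle_eq_zero_iff_of_odd (hY : IsSmoothHypersurface m d Y) (hm : m = 2 * r + 1) (hr : 1 ≤ r) :
    Module.finrank ℚ (bettiCohomology Y m) = 0 ↔ d ≤ 2 := by
  refine ⟨fun hb ↦ ?_, fun hd ↦ hY.finrank_bettiCohomology_middle_eq_zero_of_degree_le_two hm hd⟩
  by_contra hd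
  have key := hY.mul_finrank_bettiCohomology_middle_odd_add hm hr
  have hlt : (d - 1) ^ 1 < (d - 1) ^ (m + 2) := Nat.pow_lt_pow_right (by omega) (by omega)
  rw [hb, mul_zero, zero_add] at key
  rw [pow_one, ← key] at hlt
  exact lt_irrefl _ hlt

/-- **`0 < b_{2r+1}(Y) ⟺ 3 ≤ d`**: every smooth hypersurface of odd dimension `≥ 3` and degree `≥ 3` has middle cohomology. [cite: Huybrechts2023Cubic, Ch. 1 §1.3 Cor. 1.12] -/
theorem finrank_bettiCohomology_middle_pos_iff_of_odd (hY : IsSmoothHypersurface m d Y) (hm : m = 2 * r + 1) (hr : 1 ≤ r) :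
    0 < Module.finrank ℚ (bettiCohomology Y m) ↔ 3 ≤ d := by
  rw [pos_iff_ne_zero, Ne, hY.finrank_bettiCohomology_middle_eq_zero_iff_of_odd hm hr]
  omega

/-- **`b₃(T) = 10` for a smooth cubic threefold** (Clemens–Griffiths; Table 5.1; Huybrechts Ch. 5 §0.1). [cite: EisenbudHarris2016, Example 5.24 and Table 5.1] [cite: Huybrechts2023Cubic, Ch. 5 §0.1 (p. 226) and Ch. 1 §1.3 table] -/
theorem finrank_bettiCohomology_three_cubicThreefold (hT : IsSmoothHypersurface 3 3 T) : Module.finrank ℚ (bettiCohomology T 3) = 10 := by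
  rw [hT.finrank_bettiCohomology_middle_odd_eq_div (r := 1) rfl le_rfl]
  norm_num

/-- **`b₃(T) = 60` for a smooth quartic threefold.** [cite: EisenbudHarris2016, Example 5.24 and Table 5.1] -/
theorem finrank_bettiCohomology_three_quarticThreefold (hT : IsSmoothHypersurface 3 4 T) : Module.finrank ℚ (bettiCohomology T 3) = 60 := by
  rw [hT.finrank_bettiCohomology_middle_odd_eq_div (r := 1) rfl le_rfl]
  norm_num

/-- **`b₃(T) = 204` for a smooth quintic threefold.** [cite: EisenbudHarris2016, Example 5.24 and Table 5.1] -/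
theorem finrank_bettiCohomology_three_quinticThreefold (hT : IsSmoothHypersurface 3 5 T) : Module.finrank ℚ (bettiCohomology T 3) = 204 := by
  rw [hT.finrank_bettiCohomology_middle_odd_eq_div (r := 1) rfl le_rfl]
  norm_num

/-- `b₃(T) = 520` for a smooth sextic threefold (`(5⁵ − 5)/6`). [cite: EisenbudHarris2016, Example 5.24] [cite: Huybrechts2023Cubic, Ch. 1 §1.3 Cor. 1.12] -/
theorem finrank_bettiCohomology_three_sexticThreefold (hT : IsSmoothHypersurface 3 6 T) : Module.finrank ℚ (bettiCohomology T 3) = 520 := by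
  rw [hT.finrank_bettiCohomology_middle_odd_eq_div (r := 1) rfl le_rfl]
  norm_num

/-- **`b₃` of a smooth threefold of degree `d` in `ℙ⁴`: `b₃(T) + (d−1)³ + (d−1) = (d−1)⁴ + (d−1)²`**, i.e. `b₃ = (d−1)⁴ − (d−1)³ + (d−1)² − (d−1) = d⁴ − 5d³ + 10d² − 10d + 4` (the abstract form of the tree's
`finrank_bettiCohomology_three_hypersurface_add`). [cite: EisenbudHarris2016, Example 5.24 and Table 5.1] [cite: Huybrechts2023Cubic, Ch. 1 §1.3 Cor. 1.12] -/
theorem finrank_bettiCohomology_three_threefold_add (hT : IsSmoothHypersurface 3 d T) :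
    Module.finrank ℚ (bettiCohomology T 3) + (d - 1) ^ 3 + (d - 1) = (d - 1) ^ 4 + (d - 1) ^ 2 := by
  haveI : NeZero d := ⟨(pos_of_isSmoothHypersurface hT).ne'⟩
  obtain ⟨F, hF, -, hJ, ⟨e⟩⟩ := hT.exists_isNonsingularForm_iso_hypersurface
  rw [BettiUniverse.finrank_bettiCohomology_eq_of_iso e 3]
  exact finrank_bettiCohomology_three_hypersurface_add F hF hJ

/-- **`b₅(X) = 42` for a smooth cubic fivefold** (Huybrechts' table, `n = 5`). [cite: Huybrechts2023Cubic, Ch. 1 §1.3 Cor. 1.12 and the table (p. 24)] -/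
theorem finrank_bettiCohomology_five_cubicFivefold (hX : IsSmoothHypersurface 5 3 X) : Module.finrank ℚ (bettiCohomology X 5) = 42 := by
  rw [hX.finrank_bettiCohomology_middle_odd_eq_div (r := 2) rfl (by norm_num)]
  norm_num

/-- `b₇(X) = 170` for a smooth cubic sevenfold (Huybrechts' table, `n = 7`). [cite: Huybrechts2023Cubic, Ch. 1 §1.3 Cor. 1.12 and the table (p. 24)] -/
theorem finrank_bettiCohomology_seven_cubicSevenfold (hX : IsSmoothHypersurface 7 3 X) : Module.finrank ℚ (bettiCohomology X 7) = 170 := by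
  rw [hX.finrank_bettiCohomology_middle_odd_eq_div (r := 3) rfl (by norm_num)]
  norm_num

end Middle

/-! ### §3 The primitive middle cohomology `Pᵐ(Y) ⊆ Hᵐ(Y)`: `dim Pᵐ = b_m − [m even]` and Cor. 1.12 verbatim -/

section Primitive

variable {κ : bettiCohomology Y 2} {κ' : complexBetti Y 2}

/-- **`dim_ℚ Pᵐ(Y) = b_m(Y)` in odd dimension `m = 2r + 1 ≥ 3`** (`Hᵐ = Pᵐ ⊕ L H^{m−2}` and `b_{m−2}(Y) = 0`), for any class `κ ∈ H²(Y(ℂ); ℚ)` with the hard Lefschetz property; Huybrechts: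
«`b_n(X)_pr … equals … b_n(X)` for `n` odd (use `b_{n−2}(X) = 0`)». [cite: Huybrechts2023Cubic, Ch. 1 §1.3 (p. 23)] [cite: VoisinHodgeI2002, §6.2.3 Def. 6.24 and Cor. 6.26] -/
theorem finrank_primitiveClasses_middle_of_odd (hY : IsSmoothHypersurface m d Y) (hL : HasHardLefschetzProperty κ m) (hm : m = 2 * r + 1) (hr : 1 ≤ r) :
    Module.finrank ℚ (primitiveClasses κ m m) = Module.finrank ℚ (bettiCohomology Y m) := by
  have h := BettiUniverse.finrank_primitiveClasses_add_finrank hY.1 hL (show m - 2 + 2 = m by omega) le_rfl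
  rw [hY.finrank_bettiCohomology_eq_zero_of_odd (k := m - 2) ⟨r - 1, by omega⟩ (by omega), add_zero] at h
  exact h

/-- **`dim_ℚ Pᵐ(Y) + 1 = b_m(Y)` in even dimension `m = 2r ≥ 2`** (`b_{m−2}(Y) = 1`); Huybrechts: «`b_n(X)_pr … equals `b_n(X) − 1` for even `n > 0`». [cite: Huybrechts2023Cubic, Ch. 1 §1.3 (p. 23)]
[cite: VoisinHodgeI2002, §6.2.3 Def. 6.24 and Cor. 6.26] -/
theorem finrank_primitiveClasses_middle_add_one_of_even (hY : IsSmoothHypersurface m d Y) (hL : HasHardLefschetzProperty κ m) (hm : m = 2 * r) (hr : 1 ≤ r) :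
    Module.finrank ℚ (primitiveClasses κ m m) + 1 = Module.finrank ℚ (bettiCohomology Y m) := by
  have h := BettiUniverse.finrank_primitiveClasses_add_finrank hY.1 hL (show m - 2 + 2 = m by omega) le_rfl
  rw [show m - 2 = 2 * (r - 1) by omega, hY.finrank_bettiCohomology_two_mul_eq_one (p := r - 1) (by omega) (by omega)] at h
  exact h

/-- **The primitive middle Betti number in closed form: `d · dim_ℚ Pᵐ(Y) = (d−1)^{m+2} + (−1)^m (d−1)`** (`m ≥ 2`, any hard-Lefschetz class `κ ∈ H²(Y(ℂ); ℚ)`).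
[cite: Huybrechts2023Cubic, Ch. 1 §1.3 Cor. 1.12] -/
theorem natCast_mul_finrank_primitiveClasses_middle (hY : IsSmoothHypersurface m d Y) (hL : HasHardLefschetzProperty κ m) (hm : 2 ≤ m) :
    (d : ℤ) * (Module.finrank ℚ (primitiveClasses κ m m) : ℤ) = ((d : ℤ) - 1) ^ (m + 2) + (-1) ^ m * ((d : ℤ) - 1) := by
  rw [← hY.natCast_mul_finrank_bettiCohomology_middle_sub hm]
  congr 1
  rcases Nat.even_or_odd m with ⟨r, hr⟩ | ⟨r, hr⟩
  · rw [if_pos ⟨r, hr⟩, ← hY.finrank_primitiveClasses_middle_add_one_of_even hL (show m = 2 * r by omega) (by omega)]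
    push_cast
    ring
  · rw [if_neg (Nat.not_even_iff_odd.2 ⟨r, hr⟩), hY.finrank_primitiveClasses_middle_of_odd hL hr (by omega), sub_zero]

/-- **Corollary 1.12 (Huybrechts) verbatim: `b_m(Y)_pr = ((−1)^m / d) · (d − 1 + (1 − d)^{m+2})`**, i.e. `d · dim_ℚ Pᵐ(Y) = (−1)^m (d − 1 + (1−d)^{m+2})` in `ℤ` (`m ≥ 2`; for `d = 3`:
`b_{m,pr} = (−1)^m (2/3)(1 + (−1)^m 2^{m+1})`). [cite: Huybrechts2023Cubic, Ch. 1 §1.3 Cor. 1.12 (held text p. 23)] -/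
theorem natCast_mul_finrank_primitiveClasses_middle_eq_neg_one_pow_mul (hY : IsSmoothHypersurface m d Y) (hL : HasHardLefschetzProperty κ m) (hm : 2 ≤ m) :
    (d : ℤ) * (Module.finrank ℚ (primitiveClasses κ m m) : ℤ) = (-1) ^ m * ((d : ℤ) - 1 + (1 - (d : ℤ)) ^ (m + 2)) := by
  rw [hY.natCast_mul_finrank_primitiveClasses_middle hL hm, show (1 - (d : ℤ)) = -((d : ℤ) - 1) by ring]
  rcases Nat.even_or_odd m with ⟨r, hr⟩ | ⟨r, hr⟩
  · have he : Even (m + 2) := ⟨r + 1, by omega⟩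
    rw [he.neg_pow, Even.neg_one_pow ⟨r, hr⟩]
    ring
  · have ho : Odd (m + 2) := ⟨r + 1, by omega⟩
    rw [ho.neg_pow, Odd.neg_one_pow ⟨r, hr⟩]
    ring

/-- The same with COMPLEX coefficients: **`d · dim_ℂ Pᵐ_ℂ(Y) = (d−1)^{m+2} + (−1)^m (d−1)`** for any hard-Lefschetz class `κ' ∈ H²(Y(ℂ); ℂ)` (`dim_ℂ Pᵐ_ℂ = b_m − b_{m−2}` as well).
[cite: Huybrechts2023Cubic, Ch. 1 §1.3 Cor. 1.12] [cite: VoisinHodgeI2002, §6.2.3 Cor. 6.26 and Rem. 6.27] -/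
theorem natCast_mul_finrank_primitiveClasses_complex_middle (hY : IsSmoothHypersurface m d Y) (hL : HasHardLefschetzProperty κ' m) (hm : 2 ≤ m) :
    (d : ℤ) * (Module.finrank ℂ (primitiveClasses κ' m m) : ℤ) = ((d : ℤ) - 1) ^ (m + 2) + (-1) ^ m * ((d : ℤ) - 1) := by
  rw [← hY.natCast_mul_finrank_bettiCohomology_middle_sub hm]
  congr 1
  have h := BettiUniverse.finrank_primitiveClasses_complex_add_finrank hY.1 hL (show m - 2 + 2 = m by omega) le_rfl
  rcases Nat.even_or_odd m with ⟨r, hr⟩ | ⟨r, hr⟩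
  · rw [show m - 2 = 2 * (r - 1) by omega, hY.finrank_bettiCohomology_two_mul_eq_one (p := r - 1) (by omega) (by omega)] at h
    rw [if_pos ⟨r, hr⟩, ← h]
    push_cast
    ring
  · rw [hY.finrank_bettiCohomology_eq_zero_of_odd (k := m - 2) ⟨r - 1, by omega⟩ (by omega), add_zero] at h
    rw [if_neg (Nat.not_even_iff_odd.2 ⟨r, hr⟩), h, sub_zero]

end Primitive

/-! ### §4 The Euler number: `E(Y) = m + 1 − ((d−1)^{m+2} − (d−1))/d` in odd dimension, `d · E(Y) = (1−d)^{m+2} + d(m+2) − 1` in every dimension -/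

section Euler

/-- **THE EULER CHARACTERISTIC OF A SMOOTH HYPERSURFACE OF ODD DIMENSION in closed form: `E(Y) = m + 1 − ((d−1)^{m+2} − (d−1))/d`** (`m = 2r + 1 ≥ 3`; EQUALITY, closing the one-sided
`le_eulerChar_of_odd` of g41-#5; Table 5.1: cubic∕quartic∕quintic threefold `−6, −56, −200`). [cite: EisenbudHarris2016, Example 5.24 and Table 5.1 (held text p. 211)]
[cite: Huybrechts2023Cubic, Ch. 1 §1.3 (p. 22)] -/
theorem eulerChar_eq_sub_div_of_odd (hY : IsSmoothHypersurface m d Y) (hm : m = 2 * r + 1) (hr : 1 ≤ r) :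
    ∑ k ∈ range (2 * m + 1), (-1 : ℤ) ^ k * (Module.finrank ℚ (bettiCohomology Y k) : ℤ) = (m : ℤ) + 1 - ((((d - 1) ^ (m + 2) - (d - 1)) / d : ℕ) : ℤ) := by
  rw [hY.eulerChar_eq_of_odd ⟨r, hm⟩, hY.finrank_bettiCohomology_middle_odd_eq_div hm hr]

/-- **`d · E(Y) = (1 − d)^{m+2} + d(m+2) − 1` for every smooth hypersurface of dimension `m ≥ 2` and degree `d`** (Huybrechts: «`e(X) = (1/d)((1−d)^{n+2} + d(n+2) − 1)`» from
`c(X) = (1+h)^{n+2}(1+dh)^{−1}`; Eisenbud–Harris: `χ_top(X) = Σ_{i=0}^{n−1} (−1)^i C(n+1, n−1−i) d^{i+1}` for `X ⊂ ℙⁿ`). [cite: Huybrechts2023Cubic, Ch. 1 §1.3 (held text p. 23)]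
[cite: EisenbudHarris2016, Example 5.24] -/
theorem natCast_mul_eulerChar (hY : IsSmoothHypersurface m d Y) (hm : 2 ≤ m) :
    (d : ℤ) * ∑ k ∈ range (2 * m + 1), (-1 : ℤ) ^ k * (Module.finrank ℚ (bettiCohomology Y k) : ℤ) = (1 - (d : ℤ)) ^ (m + 2) + d * (m + 2) - 1 := by
  have key := hY.natCast_mul_finrank_bettiCohomology_middle_sub hm
  rw [show (1 - (d : ℤ)) = -((d : ℤ) - 1) by ring]
  rcases Nat.even_or_odd m with ⟨r, hr⟩ | ⟨r, hr⟩
  · have he : Even (m + 2) := ⟨r + 1, by omega⟩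
    rw [hY.eulerChar_eq_of_even ⟨r, hr⟩, he.neg_pow]
    rw [if_pos ⟨r, hr⟩, Even.neg_one_pow ⟨r, hr⟩] at key
    linear_combination key
  · have ho : Odd (m + 2) := ⟨r + 1, by omega⟩
    rw [hY.eulerChar_eq_of_odd ⟨r, hr⟩, ho.neg_pow]
    rw [if_neg (Nat.not_even_iff_odd.2 ⟨r, hr⟩), Odd.neg_one_pow ⟨r, hr⟩] at key
    linear_combination -key

/-- **The Euler characteristic of a smooth threefold of degree `d` in `ℙ⁴`: `E(T) = −d⁴ + 5d³ − 10d² + 10d`** (`Σ_{i=0}^{3} (−1)^i C(5, 3−i) d^{i+1}`; Table 5.1: `4, −6, −56, −200` for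
`d = 2, 3, 4, 5`). [cite: EisenbudHarris2016, Example 5.24 and Table 5.1 (held text p. 211)] [cite: Huybrechts2023Cubic, Ch. 1 §1.3] -/
theorem eulerChar_threefold (hT : IsSmoothHypersurface 3 d T) :
    ∑ k ∈ range (2 * 3 + 1), (-1 : ℤ) ^ k * (Module.finrank ℚ (bettiCohomology T k) : ℤ) = -(d : ℤ) ^ 4 + 5 * (d : ℤ) ^ 3 - 10 * (d : ℤ) ^ 2 + 10 * d := by
  have hd : (d : ℤ) ≠ 0 := Nat.cast_ne_zero.2 (pos_of_isSmoothHypersurface hT).ne'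
  have key := hT.natCast_mul_eulerChar (by norm_num)
  refine mul_left_cancel₀ hd ?_
  rw [key]
  push_cast
  ring

/-- **`E(T) = −6` for a smooth cubic threefold** (`b₃ = 10`). [cite: EisenbudHarris2016, Example 5.24 and Table 5.1] [cite: Huybrechts2023Cubic, Ch. 5 §0.1 (p. 227) and Ch. 1 §1.3 (1.6)] -/
theorem eulerChar_cubicThreefold (hT : IsSmoothHypersurface 3 3 T) : ∑ k ∈ range (2 * 3 + 1), (-1 : ℤ) ^ k * (Module.finrank ℚ (bettiCohomology T k) : ℤ) = -6 := by
  rw [hT.eulerChar_threefold]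
  norm_num

/-- `E(T) = −56` for a smooth quartic threefold (`b₃ = 60`). [cite: EisenbudHarris2016, Example 5.24 and Table 5.1] -/
theorem eulerChar_quarticThreefold (hT : IsSmoothHypersurface 3 4 T) : ∑ k ∈ range (2 * 3 + 1), (-1 : ℤ) ^ k * (Module.finrank ℚ (bettiCohomology T k) : ℤ) = -56 := by
  rw [hT.eulerChar_threefold]
  norm_num

/-- `E(T) = −200` for a smooth quintic threefold (`b₃ = 204`). [cite: EisenbudHarris2016, Example 5.24 and Table 5.1] -/
theorem eulerChar_quinticThreefold (hT : IsSmoothHypersurface 3 5 T) : ∑ k ∈ range (2 * 3 + 1), (-1 : ℤ) ^ k * (Module.finrank ℚ (bettiCohomology T k) : ℤ) = -200 := by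
  rw [hT.eulerChar_threefold]
  norm_num

/-- `E(X) = −36` for a smooth cubic fivefold (Huybrechts' table, `n = 5`; `b₅ = 42`). [cite: Huybrechts2023Cubic, Ch. 1 §1.3 (1.6) and the table (p. 24)] -/
theorem eulerChar_cubicFivefold (hX : IsSmoothHypersurface 5 3 X) : ∑ k ∈ range (2 * 5 + 1), (-1 : ℤ) ^ k * (Module.finrank ℚ (bettiCohomology X k) : ℤ) = -36 := by
  rw [hX.eulerChar_eq_sub_div_of_odd (r := 2) rfl (by norm_num)]
  norm_num

end Euler

/-! ### §5 Cubic hypersurfaces in every dimension (Huybrechts (1.6), Exercises 1.13–1.14) -/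

section Cubic

/-- **Exercise 1.14 (Huybrechts): `b_m(Y) = (2^{m+3} + 3 + (−1)^m · 7)/6` for a smooth cubic hypersurface of dimension `m ≥ 2`**, as `6 b_m = 2^{m+3} + 3 + (−1)^m 7` in `ℤ` (`7, 10, 23, 42, 87,
170, 343, 682, 1367`). [cite: Huybrechts2023Cubic, Ch. 1 §1.3 Exercise 1.14 and the table (held text p. 24)] -/
theorem six_mul_finrank_bettiCohomology_middle_cubic (hY : IsSmoothHypersurface m 3 Y) (hm : 2 ≤ m) :
    6 * (Module.finrank ℚ (bettiCohomology Y m) : ℤ) = 2 ^ (m + 3) + 3 + (-1) ^ m * 7 := by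
  have key := hY.natCast_mul_finrank_bettiCohomology_middle_sub hm
  push_cast at key
  rcases Nat.even_or_odd m with ⟨r, hr⟩ | ⟨r, hr⟩
  · rw [if_pos ⟨r, hr⟩, Even.neg_one_pow ⟨r, hr⟩] at key
    rw [Even.neg_one_pow ⟨r, hr⟩]
    linear_combination 2 * key
  · rw [if_neg (Nat.not_even_iff_odd.2 ⟨r, hr⟩), Odd.neg_one_pow ⟨r, hr⟩] at key
    rw [Odd.neg_one_pow ⟨r, hr⟩]
    linear_combination 2 * key

/-- **(1.6) (Huybrechts): `e(Y) = ((−2)^{m+2} + 3m + 5)/3` for a smooth cubic hypersurface of dimension `m ≥ 2`**, as `3 E(Y) = (−2)^{m+2} + 3m + 5` (`9, −6, 27, −36, 93, −162, 351`).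
[cite: Huybrechts2023Cubic, Ch. 1 §1.3 (1.6) and the table (held text pp. 23–24)] -/
theorem three_mul_eulerChar_cubic (hY : IsSmoothHypersurface m 3 Y) (hm : 2 ≤ m) :
    3 * ∑ k ∈ range (2 * m + 1), (-1 : ℤ) ^ k * (Module.finrank ℚ (bettiCohomology Y k) : ℤ) = (-2) ^ (m + 2) + 3 * m + 5 := by
  have key := hY.natCast_mul_eulerChar hm
  push_cast at key
  rw [key]
  ring

/-- **Exercise 1.13 (Huybrechts) in absolute form: `b_{m+1}(Y″) + 1 = 2 b_{m−1}(Y) + b_m(Y′)` for smooth cubic hypersurfaces `Y, Y′, Y″` of dimensions `m − 1 ≥ 2`, `m`, `m + 1`**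
(printed for the primitive numbers, `b_{n+1,pr} = 2 b_{n−1,pr} + b_{n,pr}`; `23 + 1 = 2·7 + 10`, `42 + 1 = 2·10 + 23`, `87 + 1 = 2·23 + 42`). [cite: Huybrechts2023Cubic, Ch. 1 §1.3 Exercise 1.13 (held text p. 24)] -/
theorem finrank_bettiCohomology_middle_cubic_succ_add_one {k : ℕ} (hY : IsSmoothHypersurface (k + 2) 3 Y) (hY' : IsSmoothHypersurface (k + 3) 3 Y') (hY'' : IsSmoothHypersurface (k + 4) 3 Y'') :
    Module.finrank ℚ (bettiCohomology Y'' (k + 4)) + 1 = 2 * Module.finrank ℚ (bettiCohomology Y (k + 2)) + Module.finrank ℚ (bettiCohomology Y' (k + 3)) := by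
  have h := hY.six_mul_finrank_bettiCohomology_middle_cubic (by omega)
  have h' := hY'.six_mul_finrank_bettiCohomology_middle_cubic (by omega)
  have h'' := hY''.six_mul_finrank_bettiCohomology_middle_cubic (by omega)
  have key : 6 * ((Module.finrank ℚ (bettiCohomology Y'' (k + 4)) : ℤ) + 1) =
      6 * (2 * (Module.finrank ℚ (bettiCohomology Y (k + 2)) : ℤ) + (Module.finrank ℚ (bettiCohomology Y' (k + 3)) : ℤ)) := by
    linear_combination h'' - 2 * h - h'
  omega

/-- **Exercise 1.14 (Huybrechts), second form: `b_{2r+1} = 2 b_{2r} − 4` for smooth cubic hypersurfaces `Y, Y′` of dimensions `2r ≥ 2` and `2r + 1`** (`10 = 2·7 − 4`, `42 = 2·23 − 4`,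
`170 = 2·87 − 4`). [cite: Huybrechts2023Cubic, Ch. 1 §1.3 Exercise 1.14 (held text p. 24)] -/
theorem finrank_bettiCohomology_middle_cubic_odd_add_four (hY : IsSmoothHypersurface m 3 Y) (hY' : IsSmoothHypersurface (m + 1) 3 Y') (hm : m = 2 * r) (hr : 1 ≤ r) :
    Module.finrank ℚ (bettiCohomology Y' (m + 1)) + 4 = 2 * Module.finrank ℚ (bettiCohomology Y m) := by
  have h := hY.six_mul_finrank_bettiCohomology_middle_cubic (by omega)
  have h' := hY'.six_mul_finrank_bettiCohomology_middle_cubic (by omega)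
  rw [hm, Even.neg_one_pow ⟨r, by ring⟩] at h
  rw [hm, Odd.neg_one_pow ⟨r, by ring⟩] at h'
  have key : 6 * ((Module.finrank ℚ (bettiCohomology Y' (m + 1)) : ℤ) + 4) = 6 * (2 * (Module.finrank ℚ (bettiCohomology Y m) : ℤ)) := by
    rw [hm]
    linear_combination h' - 2 * h
  omega

end Cubic

end Literature.AlgebraicGeometry.Motives.IsSmoothHypersurface

end
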